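import Summits.CriticalPhenomena.PercolationContinuityZ3.Theorems.PercNearOneGluingNoHeavyRsw3TubeRateOneArm
import Summits.CriticalPhenomena.PercolationContinuityZ3.Theorems.PercNearOneGluingNoHeavyRsw3OneArmLowerEnvelope
import HarnessLib

/-!
# RSW3 lane (P2, gen 8): the p-UNIFORM FINITE-WIDTH WINDOW for the tube rate of `ℤ³` —
# `0 ≤ n·μ_p(n) - n·φ(p) ≤ 8 log(n+2) + 11 log(1/p) + 20` for every `0 < p` and `n ≥ 2`

builds on p205010 (kernel theorem, internal audit signed; external expert review pending)

Cell `prim-rsw3`, prover seat `prim-rsw3-p2` (gen 8), memo `run/shared/lean/prim/rsw3/P2-RSWLITE.md` §14.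
Support file (`--supports stmt-CriticalPhenomena-4575`); no definitions, no named facts, no sorries.

`μ_p(n) = -(Crossing.subadditive_log_hardCrossing p hp n).lim` is the tube rate (inverse correlation length of the bar
`ℤ × {0..n}²`, p224483), `φ(p) = (RSW3.subadditive_oneArm _ p hp).lim` the one-arm rate (inverse bulk correlation length,
Grimmett's Thm. (6.10)).  `…Rsw3TubeRateOneArm` proved `φ(p) ≤ μ_p(n)` and `L·μ_p(2L) ≤ -log π_p(L) + log(6(2L+1)²)`;
`…Rsw3OneArmLowerEnvelope` proved Grimmett's left half `-log π_p(L) ≤ (L+5)φ(p) + log(2592 (L+2)²)` (`d = 3`).  Together: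
* `mul_rate_le_even` — `2L·μ_p(2L) ≤ (2L+10)·φ(p) + 2 log(15552·(L+2)²(2L+1)²)` (`L ≥ 1`);
* `mul_rate_le_window` — **`n·μ_p(n) ≤ n·φ(p) + 11·log(1/p) + 8 log(n+2) + 20` for every `n ≥ 2`** (odd widths by
  `μ_p(2L+1) ≤ μ_p(2L) ≤ log(1/p)`, `φ(p) ≤ log(1/p)`), with `0 ≤ n·μ_p(n) - n·φ(p)` (`lim_oneArm_le_rate`):
  **the inverse correlation length of the bar of width `n` equals the bulk one up to `(8 log(n+2) + 11 log(1/p) + 20)/n`,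
  uniformly in `p`.**
READING (numbers, not adjectives).  In units of the width, `n μ_p(n) = n/ξ(p) + E_p(n)` with a finite-width excess
`0 ≤ E_p(n) ≤ 8 log(n+2) + 11 log(1/p) + 20` at EVERY `p`; at `p_c(ℤ³)` (`φ = 0`) this is `n μ_{p_c}(n) ≤ 8 log(n+2) + C` (the tree's
sharper critical constant `4 log n + C`, p224958/p225233, uses `π_{p_c}(L) ≥ c/L` in place of (6.11)); hard-direction 3D RSW
(all aspects, geometric constants) is EQUIVALENT to `E_{p_c}(n) = O(1)` (p224958), census `E_{p_c}(n) ≈ 2.74` flat (non-rigorous).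
What is new is p-uniformity: the critical log-window is the `p = p_c` member of a near-critical family, and any proof of RSW
through the tube rate must improve the excess, not the bulk term.  Nothing uniform is claimed.

References: G. Grimmett, *Percolation* (1999), Thm. (6.10)–(6.14), (6.44); M. E. Fisher, in *Critical Phenomena*, Proc.
Enrico Fermi School LI (1971) (finite-size scaling); J. T. Chayes, L. Chayes, D. S. Fisher, T. Spencer, Phys. Rev. Lett. 57
(1986) 2999. [folklore]
-/

noncomputable section

namespace Summit.CriticalPhenomena.PercolationContinuityZ3.Theorems

open MeasureTheory ProbabilityTheory Filter Topology
open Literature.Probability.Percolation Literature.Probability.LatticeModels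

namespace Rsw3

open SurfaceTension Crossing

/-- **Even widths**: `2L·μ_p(2L) ≤ (2L+10)·φ(p) + 2·log(15552·(L+2)²·(2L+1)²)` for every `0 < p`, `L ≥ 1`
(`rate_mul_le_neg_log_oneArmProb` + `neg_log_oneArmProb_le_mul_lim_oneArm` at `d = 3`: `2·3·4²·3³ = 2592`, `2592·6 = 15552`).
[folklore] -/
theorem mul_rate_le_even (p : unitInterval) (hp : 0 < (p : ℝ)) {L : ℕ} (hL : 1 ≤ L) :
    2 * (L : ℝ) * -(Crossing.subadditive_log_hardCrossing p hp (2 * L)).lim ≤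
      (2 * (L : ℝ) + 10) * (RSW3.subadditive_oneArm (d := 3) (by norm_num) p hp).lim +
        2 * Real.log (15552 * ((L : ℝ) + 2) ^ 2 * (2 * (L : ℝ) + 1) ^ 2) := by
  have h1 := rate_mul_le_neg_log_oneArmProb p hp hL
  have h2 := neg_log_oneArmProb_le_mul_lim_oneArm (d := 3) (by norm_num) p hp L
  have hL0 : (0 : ℝ) < L := by exact_mod_cast hL
  have hlog : Real.log (2 * (3 : ℕ) * (4 : ℝ) ^ (3 - 1) * (3 : ℝ) ^ 3 * ((L : ℝ) + 2) ^ (3 - 1)) +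
      Real.log (6 * (2 * (L : ℝ) + 1) ^ 2) = Real.log (15552 * ((L : ℝ) + 2) ^ 2 * (2 * (L : ℝ) + 1) ^ 2) := by
    rw [← Real.log_mul (by positivity) (by positivity)]
    congr 1
    push_cast
    ring
  nlinarith [hlog]

/-- **THE p-UNIFORM FINITE-WIDTH WINDOW** (every `0 < p`, every `n ≥ 2`, `ℤ³`):
`n·μ_p(n) ≤ n·φ(p) + 11·(-log p) + 8·log(n+2) + 20` — with `n·φ(p) ≤ n·μ_p(n)` (`lim_oneArm_le_rate`) the tube rate equals the
one-arm rate up to `(8 log(n+2) + 11 log(1/p) + 20)/n`, uniformly in `p`.  Even `n = 2L`: `mul_rate_le_even` and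
`(L+2)(2L+1) ≤ (n+2)²`, `φ ≤ log(1/p)`; odd `n = 2L+1`: `μ_p(n) ≤ μ_p(2L)` (`Crossing.rate_succ_le`) and `μ_p(2L) ≤ log(1/p)`
(`Crossing.rate_le_neg_log`). [folklore] -/
theorem mul_rate_le_window (p : unitInterval) (hp : 0 < (p : ℝ)) {n : ℕ} (hn : 2 ≤ n) :
    (n : ℝ) * -(Crossing.subadditive_log_hardCrossing p hp n).lim ≤
      (n : ℝ) * (RSW3.subadditive_oneArm (d := 3) (by norm_num) p hp).lim +
        11 * -Real.log p + 8 * Real.log ((n : ℝ) + 2) + 20 := by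
  set φ := (RSW3.subadditive_oneArm (d := 3) (by norm_num) p hp).lim with hφ
  have hp1 : (p : ℝ) ≤ 1 := p.2.2
  have hlogp : 0 ≤ -Real.log p := by rw [neg_nonneg]; exact Real.log_nonpos hp.le hp1
  -- `φ ≤ μ_p(0) ≤ log(1/p)` and `φ ≥ 0`
  have hφle : φ ≤ -Real.log p := (lim_oneArm_le_rate p hp 0).trans (Crossing.rate_le_neg_log p hp 0)
  have hφ0 : 0 ≤ φ := RSW3.lim_oneArm_nonneg (by norm_num) p hp
  have h15552 : Real.log 15552 ≤ 10 := by
    rw [Real.log_le_iff_le_exp (by norm_num)]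
    have h := Real.exp_one_gt_d9
    have h10 : Real.exp 10 = Real.exp 1 ^ 10 := by rw [← Real.exp_nat_mul]; norm_num
    rw [h10]
    nlinarith [pow_le_pow_left₀ (by norm_num : (0 : ℝ) ≤ 2.7182818283) h.le 10]
  -- the even case at half-width `L`, in terms of `n' = 2L`
  have heven : ∀ L : ℕ, 1 ≤ L →
      2 * (L : ℝ) * -(Crossing.subadditive_log_hardCrossing p hp (2 * L)).lim ≤
        2 * (L : ℝ) * φ + 10 * -Real.log p + 8 * Real.log (2 * (L : ℝ) + 2) + 20 := by
    intro L hL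
    have h := mul_rate_le_even p hp hL
    have hL0 : (0 : ℝ) < L := by exact_mod_cast hL
    -- `log(15552 (L+2)² (2L+1)²) ≤ log 15552 + 4 log(2L+2)`
    have hlog : Real.log (15552 * ((L : ℝ) + 2) ^ 2 * (2 * (L : ℝ) + 1) ^ 2) ≤
        Real.log 15552 + 4 * Real.log (2 * (L : ℝ) + 2) := by
      have hprod : 15552 * ((L : ℝ) + 2) ^ 2 * (2 * (L : ℝ) + 1) ^ 2 ≤ 15552 * (2 * (L : ℝ) + 2) ^ 4 := by
        have h1 : ((L : ℝ) + 2) ^ 2 ≤ (2 * (L : ℝ) + 2) ^ 2 := pow_le_pow_left₀ (by positivity) (by linarith) 2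
        have h2 : (2 * (L : ℝ) + 1) ^ 2 ≤ (2 * (L : ℝ) + 2) ^ 2 := pow_le_pow_left₀ (by positivity) (by linarith) 2
        nlinarith [mul_le_mul h1 h2 (by positivity) (by positivity)]
      calc Real.log (15552 * ((L : ℝ) + 2) ^ 2 * (2 * (L : ℝ) + 1) ^ 2)
          ≤ Real.log (15552 * (2 * (L : ℝ) + 2) ^ 4) := Real.log_le_log (by positivity) hprod
        _ = Real.log 15552 + 4 * Real.log (2 * (L : ℝ) + 2) := by
            rw [Real.log_mul (by norm_num) (by positivity), Real.log_pow]; push_cast; ring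
    nlinarith [hlog, hφle, hφ0]
  obtain ⟨L, hL⟩ : ∃ L, n = 2 * L ∨ n = 2 * L + 1 := ⟨n / 2, by omega⟩
  -- (no `push_cast` on goals containing the rate: its hidden function argument carries casts)
  rcases hL with rfl | rfl
  · -- even width
    have hL1 : 1 ≤ L := by omega
    have h := heven L hL1
    have hcast : ((2 * L : ℕ) : ℝ) = 2 * (L : ℝ) := by push_cast; ring
    rw [hcast]
    linarith
  · -- odd width: `μ(2L+1) ≤ μ(2L) ≤ log(1/p)`
    have hL1 : 1 ≤ L := by omega
    have h := heven L hL1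
    have hmono := Crossing.rate_succ_le p hp (2 * L)
    have hμle := Crossing.rate_le_neg_log p hp (2 * L)
    have hL0 : (0 : ℝ) < L := by exact_mod_cast hL1
    have hlogmono : Real.log (2 * (L : ℝ) + 2) ≤ Real.log (2 * (L : ℝ) + 1 + 2) :=
      Real.log_le_log (by positivity) (by linarith)
    have hprod : (2 * (L : ℝ) + 1) * -(Crossing.subadditive_log_hardCrossing p hp (2 * L + 1)).lim ≤
        (2 * (L : ℝ) + 1) * -(Crossing.subadditive_log_hardCrossing p hp (2 * L)).lim :=
      mul_le_mul_of_nonneg_left hmono (by positivity)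
    have hcast : ((2 * L + 1 : ℕ) : ℝ) = 2 * (L : ℝ) + 1 := by push_cast; ring
    rw [hcast]
    nlinarith [hprod, hμle, h, hφle, hφ0, hlogmono]

/-- **At `p_c(ℤ³)`**: `n·μ_{p_c}(n) ≤ 8 log(n+2) + 11 log(1/p_c) + 20` for every `n ≥ 2` — the `p = p_c` member of the window
(`φ(p_c) = 0`, `RSW3.lim_oneArm_criticalProbI_eq_zero`).  The tree's critical constant is sharper (`4 log n + C`,
`Rsw3.hardCrossingRate_criticalProbI_le`); the point of this corollary is only that the critical log-window is the endpoint
of a p-uniform one. [folklore] -/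
theorem mul_rate_criticalProbI_le_window (hp : 0 < ((criticalProbI 3 : unitInterval) : ℝ)) {n : ℕ} (hn : 2 ≤ n) :
    (n : ℝ) * -(Crossing.subadditive_log_hardCrossing (criticalProbI 3) hp n).lim ≤
      11 * -Real.log ((criticalProbI 3 : unitInterval) : ℝ) + 8 * Real.log ((n : ℝ) + 2) + 20 := by
  have h := mul_rate_le_window (criticalProbI 3) hp hn
  rw [RSW3.lim_oneArm_criticalProbI_eq_zero (d := 3) (by norm_num) hp, mul_zero, zero_add] at h
  exact h

/-- **Two-sided form**: for every `0 < p` and `n ≥ 2`,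
`|n·μ_p(n) - n·φ(p)| ≤ 8 log(n+2) + 11 log(1/p) + 20` (the left side is non-negative). [folklore] -/
theorem abs_mul_rate_sub_mul_lim_oneArm_le (p : unitInterval) (hp : 0 < (p : ℝ)) {n : ℕ} (hn : 2 ≤ n) :
    |(n : ℝ) * -(Crossing.subadditive_log_hardCrossing p hp n).lim -
        (n : ℝ) * (RSW3.subadditive_oneArm (d := 3) (by norm_num) p hp).lim| ≤
      11 * -Real.log p + 8 * Real.log ((n : ℝ) + 2) + 20 := by
  have h1 := mul_rate_le_window p hp hn
  have h2 : (n : ℝ) * (RSW3.subadditive_oneArm (d := 3) (by norm_num) p hp).lim ≤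
      (n : ℝ) * -(Crossing.subadditive_log_hardCrossing p hp n).lim :=
    mul_le_mul_of_nonneg_left (lim_oneArm_le_rate p hp n) (Nat.cast_nonneg n)
  rw [abs_le]
  constructor <;> linarith

end Rsw3

end Summit.CriticalPhenomena.PercolationContinuityZ3.Theorems

end
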